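import Literature.Analysis.Complex.VerticalSinSummation
import Literature.Analysis.SpecialFunctions.GammaVerticalBounds
import Mathlib
import HarnessLib

/-!
# HANDOFF — the DENOMINATORS of the dodger: the sinc factor paired with the top lattice point, the lower lattice factors, and the harmonic lattice sum (rh-explicit, track «HANDOFF», seat prove-2 gen9, ATTEMPT-18 (D-4), companion of `HandoffDodgerPotential`)

HONEST FRAMING. Nothing here bears on the truth of RH; this is elementary. ATTEMPT-18 (D-4) bounds the dodger's transform
`|E(z)|²/c_∞² = [|sin bz|²/(b²|z|²)] · Π_ρ|z² − z_ρ²|^{2m(ρ)} / Π_{k≤K}|z² − ℓ_k²|²` at an unkilled zero `z = γ + iη` (`|η| ≤ ½`,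
`γ > ℓ_K = πK/b`, lattice `ℓ_k = πk/b`) as DENOMINATOR PART × NUMERATOR PART, the numerator part
`Π_ρ((γ+1)² − γ_ρ²)^{2m}/Π_{k≤K}((γ+1)² − ℓ_k²)²` being the potential of `HandoffDodgerPotential.prod_killed_le_prod_lattice_mul_exp`. THIS FILE
bounds the denominator part `[|sin bz|²/(b²|z|²)]·Π_{k≤K}((γ+1)² − ℓ_k²)²/|z² − ℓ_k²|²`:

* `norm_sin_le_cosh_mul_norm` — by the complex mean value theorem on the strip `|Im w′| ≤ |Im w|` and the tree's
  `GammaVert.norm_cos_le_cosh_im` (`‖cos w‖ ≤ cosh(Im w)`): `‖sin w‖ ≤ cosh(Im w)·‖w‖`;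
* `norm_sin_lattice_shift` — `‖sin(bz)‖ = ‖sin(b(z − ℓ_K))‖` (`bℓ_K = πK`);
* **`top_factor_le`** — the `k = K` factor paired with the sinc:
  `‖sin bz‖²·((γ+1)² − ℓ_K²)² ≤ cosh²(b/2)·(1 + b)²·(γ + 1 + ℓ_K)²·‖z − ℓ_K‖²`, whatever the (possibly tiny) distance `γ − ℓ_K > 0`;
* **`lower_factor_le`** — for `0 < ℓ < γ`: `((γ+1)² − ℓ²) ≤ exp(2/(γ − ℓ))·((γ − ℓ)(γ + ℓ))` and `(γ−ℓ)(γ+ℓ) ≤ ‖z² − ℓ²‖`;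
* **`sum_inv_lattice_gap_le_harmonic`** / **`_le_log`**, **`sum_inv_lattice_gap_le_div`** — for `γ ≥ ℓ_K`:
  `Σ_{k<K−1} 1/(γ − ℓ_{k+1}) ≤ (b/π)·Σ_{j=1}^{K−1} 1/j ≤ (b/π)(1 + log(K−1))` (near zeros) and `≤ (K−1)/(γ − ℓ_{K−1})` (far zeros).
No `sorry`, standard axioms, no definitions.

References: this track (ATTEMPT-16 §4 Lemma C2 (NEAR): the pairing of `k = K` with `L` and the harmonic lattice sum `Ω₁`; ATTEMPT-18 (D-4)).
-/

set_option linter.dupNamespace false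

noncomputable section

open Real Finset Complex Set

namespace Summit.RiemannHypothesis.RiemannHypothesis.Theorems.Handoff

/-! ## `‖cos w‖ ≤ cosh(Im w)` and `‖sin w‖ ≤ cosh(Im w)‖w‖` -/

/-- **`‖sin w‖ ≤ cosh(Im w)·‖w‖`**: the mean value theorem for `sin` on the horizontal strip `{|Im w′| ≤ |Im w|}` (convex, contains `0`
and `w`), where `‖sin′‖ = ‖cos‖ ≤ cosh(Im) ≤ cosh(Im w)`. [folklore] -/
theorem norm_sin_le_cosh_mul_norm (w : ℂ) : ‖Complex.sin w‖ ≤ Real.cosh w.im * ‖w‖ := by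
  set S : Set ℂ := {u : ℂ | |u.im| ≤ |w.im|} with hS
  have hconv : Convex ℝ S := by
    have : S = Complex.im ⁻¹' Set.Icc (-|w.im|) |w.im| := by
      ext u; simp [hS, abs_le]
    rw [this]
    exact (convex_Icc _ _).linear_preimage Complex.imLm
  have h0 : (0 : ℂ) ∈ S := by simp [hS]
  have hw : w ∈ S := by simp [hS]
  have hdiff : ∀ u ∈ S, DifferentiableAt ℂ Complex.sin u := fun u _ => Complex.differentiable_sin u
  have hbound : ∀ u ∈ S, ‖deriv Complex.sin u‖ ≤ Real.cosh w.im := by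
    intro u hu
    rw [Complex.deriv_sin]
    refine (Literature.Analysis.SpecialFunctions.GammaVert.norm_cos_le_cosh_im u).trans ?_
    have hu' : |u.im| ≤ |w.im| := hu
    exact Real.cosh_le_cosh.2 hu'
  have h := hconv.norm_image_sub_le_of_norm_deriv_le hdiff hbound h0 hw
  simpa using h

/-- The lattice shift: `‖sin(bz)‖ = ‖sin(b(z − ℓ_K))‖` when `b·ℓ_K = πK`. [folklore] -/
theorem norm_sin_lattice_shift {b ℓ : ℝ} {K : ℕ} (h : b * ℓ = π * K) (z : ℂ) :
    ‖Complex.sin (b * z)‖ = ‖Complex.sin (b * (z - ℓ))‖ := by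
  have e : (b : ℂ) * z = b * (z - ℓ) + (K : ℂ) * π := by
    have : (b : ℂ) * (ℓ : ℂ) = (π : ℂ) * (K : ℂ) := by exact_mod_cast h
    linear_combination this
  rw [e, Complex.sin_antiperiodic.add_nat_mul_eq K, norm_mul, norm_pow, norm_neg, norm_one, one_pow, one_mul]

/-! ## The top lattice point, paired with the sinc -/

/-- **The `k = K` factor paired with the sinc.** For `b > 0`, `z = γ + iη` with `|η| ≤ ½`, and the top lattice point `ℓ_K` (`bℓ_K = πK`)
with `0 ≤ ℓ_K < γ`: `‖sin bz‖²·((γ+1)² − ℓ_K²)² ≤ cosh²(b/2)(1+b)²(γ+1+ℓ_K)²·‖z − ℓ_K‖²` — uniformly in the distance `γ − ℓ_K > 0`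
(for `b‖z − ℓ_K‖ ≤ 1` the sinc's zero at `ℓ_K` is used, otherwise `‖sin bz‖ ≤ cosh(b/2)`). [this track, ATTEMPT-18 (D-4)] -/
theorem top_factor_le {b γ η ℓ : ℝ} {K : ℕ} (hb : 0 < b) (hη : |η| ≤ 1 / 2) (hℓ : b * ℓ = π * K) (hℓ0 : 0 ≤ ℓ) (hℓγ : ℓ < γ) :
    ‖Complex.sin (b * ((γ : ℂ) + η * I))‖ ^ 2 * ((γ + 1) ^ 2 - ℓ ^ 2) ^ 2 ≤
      Real.cosh (b / 2) ^ 2 * (1 + b) ^ 2 * (γ + 1 + ℓ) ^ 2 * ‖((γ : ℂ) + η * I) - ℓ‖ ^ 2 := by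
  set z : ℂ := (γ : ℂ) + η * I with hz
  have hd : 0 < γ - ℓ := by linarith
  -- `‖z − ℓ‖ ≥ γ − ℓ`
  have hzℓ : γ - ℓ ≤ ‖z - ℓ‖ := by
    have := Complex.abs_re_le_norm (z - ℓ)
    have hre : (z - ℓ).re = γ - ℓ := by simp [hz]
    rw [hre, abs_of_pos hd] at this
    exact this
  have hzℓpos : 0 < ‖z - ℓ‖ := hd.trans_le hzℓ
  -- the two sinc bounds
  have him : ((b : ℂ) * (z - ℓ)).im = b * η := by simp [hz]
  have hcosh : Real.cosh (b * η) ≤ Real.cosh (b / 2) := by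
    rw [Real.cosh_le_cosh, abs_mul, abs_of_pos hb, abs_of_pos (by positivity : (0 : ℝ) < b / 2)]
    nlinarith
  have hshift : ‖Complex.sin (b * z)‖ = ‖Complex.sin (b * (z - ℓ))‖ := norm_sin_lattice_shift hℓ z
  have hs1 : ‖Complex.sin (b * z)‖ ≤ Real.cosh (b / 2) := by
    rw [hshift]
    have h := Literature.Analysis.Complex.norm_sin_sq_eq ((b : ℂ) * (z - ℓ))
    have hc : Real.cosh ((b : ℂ) * (z - ℓ)).im ^ 2 = Real.sinh ((b : ℂ) * (z - ℓ)).im ^ 2 + 1 := Real.cosh_sq _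
    have hs : Real.sin ((b : ℂ) * (z - ℓ)).re ^ 2 ≤ 1 := Real.sin_sq_le_one _
    have hpos : 0 < Real.cosh ((b : ℂ) * (z - ℓ)).im := Real.cosh_pos _
    have h2 : ‖Complex.sin (b * (z - ℓ))‖ ^ 2 ≤ Real.cosh ((b : ℂ) * (z - ℓ)).im ^ 2 := by nlinarith
    have h3 := (pow_le_pow_iff_left₀ (norm_nonneg _) hpos.le two_ne_zero).1 h2
    rw [him] at h3
    exact h3.trans hcosh
  have hs2 : ‖Complex.sin (b * z)‖ ≤ Real.cosh (b / 2) * (b * ‖z - ℓ‖) := by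
    rw [hshift]
    refine (norm_sin_le_cosh_mul_norm _).trans ?_
    rw [him, norm_mul, Complex.norm_real, Real.norm_eq_abs, abs_of_pos hb]
    exact mul_le_mul_of_nonneg_right hcosh (by positivity)
  -- `(γ+1)² − ℓ² = (γ+1−ℓ)(γ+1+ℓ)` and `γ + 1 − ℓ ≤ (1+b)·max(‖z−ℓ‖, 1/b)`-type bookkeeping
  have hA0 : 0 ≤ ‖Complex.sin (b * z)‖ := norm_nonneg _
  have hc0 : 0 < Real.cosh (b / 2) := Real.cosh_pos _
  rcases le_or_gt 1 (b * ‖z - ℓ‖) with hfar | hnear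
  · -- far from the lattice point: use `‖sin‖ ≤ cosh(b/2)` and `γ+1−ℓ ≤ (1+b)‖z−ℓ‖`
    have h1 : γ + 1 - ℓ ≤ (1 + b) * ‖z - ℓ‖ := by nlinarith
    have h2 : (γ + 1) ^ 2 - ℓ ^ 2 ≤ (1 + b) * ‖z - ℓ‖ * (γ + 1 + ℓ) := by
      have : (γ + 1) ^ 2 - ℓ ^ 2 = (γ + 1 - ℓ) * (γ + 1 + ℓ) := by ring
      rw [this]
      exact mul_le_mul_of_nonneg_right h1 (by linarith)
    have h3 : 0 ≤ (γ + 1) ^ 2 - ℓ ^ 2 := by nlinarith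
    calc ‖Complex.sin (b * z)‖ ^ 2 * ((γ + 1) ^ 2 - ℓ ^ 2) ^ 2
        ≤ Real.cosh (b / 2) ^ 2 * ((1 + b) * ‖z - ℓ‖ * (γ + 1 + ℓ)) ^ 2 := by
          refine mul_le_mul (pow_le_pow_left₀ hA0 hs1 2) (pow_le_pow_left₀ h3 h2 2) (by positivity) (by positivity)
      _ = Real.cosh (b / 2) ^ 2 * (1 + b) ^ 2 * (γ + 1 + ℓ) ^ 2 * ‖z - ℓ‖ ^ 2 := by ring
  · -- near the lattice point: use the zero of the sinc, `‖sin bz‖ ≤ cosh(b/2)·b‖z−ℓ‖`, and `γ+1−ℓ ≤ 1 + 1/b`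
    have h1 : γ + 1 - ℓ ≤ 1 + 1 / b := by
      have : γ - ℓ ≤ 1 / b := by
        rw [le_div_iff₀ hb]; nlinarith
      linarith
    have h3 : 0 ≤ (γ + 1) ^ 2 - ℓ ^ 2 := by nlinarith
    have h2 : (γ + 1) ^ 2 - ℓ ^ 2 ≤ (1 + 1 / b) * (γ + 1 + ℓ) := by
      have : (γ + 1) ^ 2 - ℓ ^ 2 = (γ + 1 - ℓ) * (γ + 1 + ℓ) := by ring
      rw [this]
      exact mul_le_mul_of_nonneg_right h1 (by linarith)
    calc ‖Complex.sin (b * z)‖ ^ 2 * ((γ + 1) ^ 2 - ℓ ^ 2) ^ 2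
        ≤ (Real.cosh (b / 2) * (b * ‖z - ℓ‖)) ^ 2 * ((1 + 1 / b) * (γ + 1 + ℓ)) ^ 2 := by
          refine mul_le_mul (pow_le_pow_left₀ hA0 hs2 2) (pow_le_pow_left₀ h3 h2 2) (by positivity) (by positivity)
      _ = Real.cosh (b / 2) ^ 2 * (1 + b) ^ 2 * (γ + 1 + ℓ) ^ 2 * ‖z - ℓ‖ ^ 2 := by
          field_simp
          ring

/-- The top factor in quotient form: with `‖z + ℓ_K‖ ≥ γ + ℓ_K` and `‖z‖ ≥ γ ≥ 1`,
`‖sin bz‖²((γ+1)²−ℓ_K²)²/(b²‖z‖²‖z−ℓ_K‖²‖z+ℓ_K‖²) ≤ 4cosh²(b/2)(1+b)²/(b²γ²)` (`(γ+1+ℓ)/(γ+ℓ) ≤ 2`). [this track, ATTEMPT-18 (D-4)] -/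
theorem top_factor_div_le {b γ η ℓ : ℝ} {K : ℕ} (hb : 0 < b) (hη : |η| ≤ 1 / 2) (hℓ : b * ℓ = π * K) (hℓ0 : 0 ≤ ℓ)
    (hℓγ : ℓ < γ) (hγ1 : 1 ≤ γ) :
    ‖Complex.sin (b * ((γ : ℂ) + η * I))‖ ^ 2 * ((γ + 1) ^ 2 - ℓ ^ 2) ^ 2 /
        (b ^ 2 * ‖(γ : ℂ) + η * I‖ ^ 2 * (‖((γ : ℂ) + η * I) - ℓ‖ ^ 2 * ‖((γ : ℂ) + η * I) + ℓ‖ ^ 2)) ≤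
      4 * Real.cosh (b / 2) ^ 2 * (1 + b) ^ 2 / (b ^ 2 * γ ^ 2) := by
  set z : ℂ := (γ : ℂ) + η * I with hz
  have h := top_factor_le (K := K) hb hη hℓ hℓ0 hℓγ
  have hzγ : γ ≤ ‖z‖ := by
    have := Complex.abs_re_le_norm z
    have hre : z.re = γ := by simp [hz]
    rw [hre, abs_of_pos (by linarith)] at this
    exact this
  have hzp : γ + ℓ ≤ ‖z + ℓ‖ := by
    have := Complex.abs_re_le_norm (z + ℓ)
    have hre : (z + ℓ).re = γ + ℓ := by simp [hz]
    rw [hre, abs_of_pos (by linarith)] at this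
    exact this
  have hd : 0 < γ - ℓ := by linarith
  have hzℓ : γ - ℓ ≤ ‖z - ℓ‖ := by
    have := Complex.abs_re_le_norm (z - ℓ)
    have hre : (z - ℓ).re = γ - ℓ := by simp [hz]
    rw [hre, abs_of_pos hd] at this
    exact this
  have hzℓpos : 0 < ‖z - ℓ‖ := hd.trans_le hzℓ
  have hden : 0 < b ^ 2 * ‖z‖ ^ 2 * (‖z - ℓ‖ ^ 2 * ‖z + ℓ‖ ^ 2) := by
    have : 0 < ‖z‖ := by linarith
    have : 0 < ‖z + ℓ‖ := by linarith
    positivity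
  rw [div_le_div_iff₀ hden (by positivity)]
  -- `(γ+1+ℓ)² ≤ 4(γ+ℓ)² ≤ 4‖z+ℓ‖²` and `γ² ≤ ‖z‖²`
  have h1 : (γ + 1 + ℓ) ^ 2 ≤ 4 * ‖z + ℓ‖ ^ 2 := by nlinarith
  have h2 : γ ^ 2 ≤ ‖z‖ ^ 2 := pow_le_pow_left₀ (by linarith) hzγ 2
  calc ‖Complex.sin (b * z)‖ ^ 2 * ((γ + 1) ^ 2 - ℓ ^ 2) ^ 2 * (b ^ 2 * γ ^ 2)
      ≤ (Real.cosh (b / 2) ^ 2 * (1 + b) ^ 2 * (γ + 1 + ℓ) ^ 2 * ‖z - ℓ‖ ^ 2) * (b ^ 2 * γ ^ 2) :=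
        mul_le_mul_of_nonneg_right h (by positivity)
    _ ≤ (Real.cosh (b / 2) ^ 2 * (1 + b) ^ 2 * (4 * ‖z + ℓ‖ ^ 2) * ‖z - ℓ‖ ^ 2) * (b ^ 2 * ‖z‖ ^ 2) := by
        gcongr
    _ = 4 * Real.cosh (b / 2) ^ 2 * (1 + b) ^ 2 * (b ^ 2 * ‖z‖ ^ 2 * (‖z - ℓ‖ ^ 2 * ‖z + ℓ‖ ^ 2)) := by ring

/-! ## The lower lattice points -/

/-- `‖z² − ℓ²‖ ≥ (γ − ℓ)(γ + ℓ)` for `z = γ + iη`, `0 ≤ ℓ ≤ γ`. [folklore] -/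
theorem sub_mul_add_le_norm_sq_sub_sq {γ η ℓ : ℝ} (hℓ0 : 0 ≤ ℓ) (hℓγ : ℓ ≤ γ) :
    (γ - ℓ) * (γ + ℓ) ≤ ‖((γ : ℂ) + η * I) ^ 2 - (ℓ : ℂ) ^ 2‖ := by
  have e : ((γ : ℂ) + η * I) ^ 2 - (ℓ : ℂ) ^ 2 = (((γ : ℂ) + η * I) - ℓ) * (((γ : ℂ) + η * I) + ℓ) := by ring
  rw [e, norm_mul]
  have h1 : γ - ℓ ≤ ‖((γ : ℂ) + η * I) - ℓ‖ := by
    have := Complex.abs_re_le_norm (((γ : ℂ) + η * I) - ℓ)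
    have hre : (((γ : ℂ) + η * I) - ℓ).re = γ - ℓ := by simp
    rw [hre, abs_of_nonneg (by linarith)] at this
    exact this
  have h2 : γ + ℓ ≤ ‖((γ : ℂ) + η * I) + ℓ‖ := by
    have := Complex.abs_re_le_norm (((γ : ℂ) + η * I) + ℓ)
    have hre : (((γ : ℂ) + η * I) + ℓ).re = γ + ℓ := by simp
    rw [hre, abs_of_nonneg (by linarith)] at this
    exact this
  exact mul_le_mul h1 h2 (by linarith) (norm_nonneg _)

/-- **A lower lattice factor.** For `0 ≤ ℓ < γ`: `(γ+1)² − ℓ² ≤ exp(2/(γ − ℓ))·((γ − ℓ)(γ + ℓ))`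
(`(γ+1−ℓ)/(γ−ℓ) = 1 + 1/(γ−ℓ) ≤ e^{1/(γ−ℓ)}`, `(γ+1+ℓ)/(γ+ℓ) ≤ 1 + 1/(γ−ℓ)`). [this track, ATTEMPT-18 (D-4)] -/
theorem lower_factor_le {γ ℓ : ℝ} (hℓ0 : 0 ≤ ℓ) (hℓγ : ℓ < γ) :
    (γ + 1) ^ 2 - ℓ ^ 2 ≤ Real.exp (2 / (γ - ℓ)) * ((γ - ℓ) * (γ + ℓ)) := by
  have hd : 0 < γ - ℓ := by linarith
  have hs : 0 < γ + ℓ := by linarith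
  have e1 : (γ + 1) ^ 2 - ℓ ^ 2 = ((γ - ℓ) * (1 + 1 / (γ - ℓ))) * ((γ + ℓ) * (1 + 1 / (γ + ℓ))) := by
    field_simp
    ring
  rw [e1]
  have h1 : 1 + 1 / (γ - ℓ) ≤ Real.exp (1 / (γ - ℓ)) := by
    have := Real.add_one_le_exp (1 / (γ - ℓ)); linarith
  have h2 : 1 + 1 / (γ + ℓ) ≤ Real.exp (1 / (γ - ℓ)) := by
    have h3 : 1 / (γ + ℓ) ≤ 1 / (γ - ℓ) := div_le_div_of_nonneg_left zero_le_one hd (by linarith)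
    have := Real.add_one_le_exp (1 / (γ - ℓ)); linarith
  have e2 : Real.exp (2 / (γ - ℓ)) = Real.exp (1 / (γ - ℓ)) * Real.exp (1 / (γ - ℓ)) := by
    rw [← Real.exp_add]; congr 1; ring
  rw [e2]
  calc ((γ - ℓ) * (1 + 1 / (γ - ℓ))) * ((γ + ℓ) * (1 + 1 / (γ + ℓ)))
      ≤ ((γ - ℓ) * Real.exp (1 / (γ - ℓ))) * ((γ + ℓ) * Real.exp (1 / (γ - ℓ))) := by
        refine mul_le_mul (mul_le_mul_of_nonneg_left h1 hd.le) (mul_le_mul_of_nonneg_left h2 hs.le)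
          (by positivity) (by positivity)
    _ = Real.exp (1 / (γ - ℓ)) * Real.exp (1 / (γ - ℓ)) * ((γ - ℓ) * (γ + ℓ)) := by ring

/-- **The product of the lower factors**: for a finite family of lattice points `0 ≤ ℓ_k < γ`,
`Π_k ((γ+1)² − ℓ_k²)/‖z² − ℓ_k²‖ ≤ exp(2·Σ_k 1/(γ − ℓ_k))`. [this track, ATTEMPT-18 (D-4)] -/
theorem prod_lower_factors_le {ι : Type*} (s : Finset ι) {ℓ : ι → ℝ} {γ η : ℝ}
    (hℓ0 : ∀ k ∈ s, 0 ≤ ℓ k) (hℓγ : ∀ k ∈ s, ℓ k < γ) :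
    ∏ k ∈ s, ((γ + 1) ^ 2 - ℓ k ^ 2) / ‖((γ : ℂ) + η * I) ^ 2 - (ℓ k : ℂ) ^ 2‖ ≤
      Real.exp (2 * ∑ k ∈ s, 1 / (γ - ℓ k)) := by
  rw [Finset.mul_sum, Real.exp_sum]
  refine Finset.prod_le_prod (fun k hk => ?_) fun k hk => ?_
  · have := hℓγ k hk; have := hℓ0 k hk
    exact div_nonneg (by nlinarith) (norm_nonneg _)
  · have hd : 0 < γ - ℓ k := by linarith [hℓγ k hk]
    have hprod : 0 < (γ - ℓ k) * (γ + ℓ k) := mul_pos hd (by linarith [hℓ0 k hk])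
    have hden : (γ - ℓ k) * (γ + ℓ k) ≤ ‖((γ : ℂ) + η * I) ^ 2 - (ℓ k : ℂ) ^ 2‖ :=
      sub_mul_add_le_norm_sq_sub_sq (hℓ0 k hk) (hℓγ k hk).le
    rw [div_le_iff₀ (hprod.trans_le hden), show 2 * (1 / (γ - ℓ k)) = 2 / (γ - ℓ k) by ring]
    exact (lower_factor_le (hℓ0 k hk) (hℓγ k hk)).trans (mul_le_mul_of_nonneg_left hden (Real.exp_pos _).le)

/-! ## The harmonic lattice sum -/

/-- **The lattice-gap sum, near form**: for `b > 0` and `γ ≥ πK/b` (e.g. `γ > ℓ_K`):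
`Σ_{k<K−1} 1/(γ − π(k+1)/b) ≤ (b/π)·Σ_{j<K−1} 1/(j+1)` (the `k`-th gap is at least `π(K−1−k)/b`). [this track, ATTEMPT-16 §4 `Ω₁`] -/
theorem sum_inv_lattice_gap_le_harmonic {b γ : ℝ} (hb : 0 < b) {K : ℕ} (hγ : π * K / b ≤ γ) :
    ∑ k ∈ Finset.range (K - 1), 1 / (γ - π * ((k + 1 : ℕ) : ℝ) / b) ≤
      b / π * ∑ j ∈ Finset.range (K - 1), 1 / ((j + 1 : ℕ) : ℝ) := by
  rw [Finset.mul_sum]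
  -- reindex `j = K − 2 − k`
  rw [← Finset.sum_range_reflect (fun j => b / π * (1 / ((j + 1 : ℕ) : ℝ))) (K - 1)]
  refine Finset.sum_le_sum fun k hk => ?_
  have hk' := Finset.mem_range.1 hk
  have hgap : π * ((K - 1 - 1 - k + 1 : ℕ) : ℝ) / b ≤ γ - π * ((k + 1 : ℕ) : ℝ) / b := by
    have e : ((K - 1 - 1 - k + 1 : ℕ) : ℝ) = (K : ℝ) - ((k + 1 : ℕ) : ℝ) := by
      have : K - 1 - 1 - k + 1 = K - (k + 1) := by omega
      rw [this, Nat.cast_sub (by omega)]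
    rw [e, mul_sub, sub_div]
    linarith
  have hpos : 0 < π * ((K - 1 - 1 - k + 1 : ℕ) : ℝ) / b := by
    have : 0 < ((K - 1 - 1 - k + 1 : ℕ) : ℝ) := by exact_mod_cast Nat.succ_pos _
    positivity
  calc 1 / (γ - π * ((k + 1 : ℕ) : ℝ) / b) ≤ 1 / (π * ((K - 1 - 1 - k + 1 : ℕ) : ℝ) / b) :=
        div_le_div_of_nonneg_left zero_le_one hpos hgap
    _ = b / π * (1 / ((K - 1 - 1 - k + 1 : ℕ) : ℝ)) := by
        field_simp

/-- **The lattice-gap sum, near form, closed**: `Σ_{k<K−1} 1/(γ − π(k+1)/b) ≤ (b/π)(1 + log(K−1))` for `γ ≥ πK/b`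
(Mathlib's `harmonic_le_one_add_log`). [this track, ATTEMPT-16 §4 `Ω₁`] -/
theorem sum_inv_lattice_gap_le_log {b γ : ℝ} (hb : 0 < b) {K : ℕ} (hγ : π * K / b ≤ γ) :
    ∑ k ∈ Finset.range (K - 1), 1 / (γ - π * ((k + 1 : ℕ) : ℝ) / b) ≤ b / π * (1 + Real.log ((K - 1 : ℕ) : ℝ)) := by
  refine (sum_inv_lattice_gap_le_harmonic hb hγ).trans (mul_le_mul_of_nonneg_left ?_ (by positivity))
  have h := harmonic_le_one_add_log (K - 1)
  have e : ((harmonic (K - 1) : ℚ) : ℝ) = ∑ j ∈ Finset.range (K - 1), 1 / ((j + 1 : ℕ) : ℝ) := by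
    rw [harmonic]; push_cast; refine Finset.sum_congr rfl fun j _ => ?_; rw [one_div]
  rw [← e]
  exact_mod_cast h

/-- **The lattice-gap sum, far form**: `Σ_{k<K−1} 1/(γ − π(k+1)/b) ≤ (K−1)/(γ − π(K−1)/b)` when `γ > π(K−1)/b` (each gap is at least the
last one). [this track, ATTEMPT-18 (D-4)] -/
theorem sum_inv_lattice_gap_le_div {b γ : ℝ} (hb : 0 < b) {K : ℕ} (hγ : π * ((K - 1 : ℕ) : ℝ) / b < γ) :
    ∑ k ∈ Finset.range (K - 1), 1 / (γ - π * ((k + 1 : ℕ) : ℝ) / b) ≤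
      ((K - 1 : ℕ) : ℝ) * (1 / (γ - π * ((K - 1 : ℕ) : ℝ) / b)) := by
  have h : ∀ k ∈ Finset.range (K - 1), 1 / (γ - π * ((k + 1 : ℕ) : ℝ) / b) ≤ 1 / (γ - π * ((K - 1 : ℕ) : ℝ) / b) := by
    intro k hk
    have hk' : ((k + 1 : ℕ) : ℝ) ≤ ((K - 1 : ℕ) : ℝ) := by exact_mod_cast Finset.mem_range.1 hk
    refine div_le_div_of_nonneg_left zero_le_one (by linarith) ?_
    have := mul_le_mul_of_nonneg_left hk' Real.pi_pos.le
    have := div_le_div_of_nonneg_right this hb.le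
    linarith
  refine (Finset.sum_le_sum h).trans (le_of_eq ?_)
  rw [Finset.sum_const, Finset.card_range, nsmul_eq_mul]

end Summit.RiemannHypothesis.RiemannHypothesis.Theorems.Handoff

end
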